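import Literature.NumberTheory.NumberFields.SymmetricThreeFixedClassesDescent
import HarnessLib

/-!
# The EXACT `2`-part of the `S₃` class number relation:
# `ord₂ h(L) + 2·ord₂ h(L^{⟨σ,τ⟩}) = ord₂ h(L^{⟨σ⟩}) + 2·ord₂ h(L^{⟨τ⟩})` (Walter; Caputo–Nuccio Prop. 3.12)

Topic `NumberTheory/NumberFields`; namespace `Literature.NumberTheory.NumberFields.KurodaSymmetricThree`.
THEOREM-ONLY file (no definition, no named fact, no `sorry`), written by the prover seat `bsd-line-att-p4` g30
(cell `bsd-f1-sign2`, route `AlignedTransportAtTwo`, `--supports` stmt-BirchSwinnertonDyer-22298 — the sextic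
`ℚ(W[2])` of an elliptic curve is an `S₃`-extension with cubic subfield `ℚ(β)` and resolvent `ℚ(√Δ)`; closes
nothing; BSD is proved for no curve here).

## Statement (`padicValNat_two_classNumber_symmetricThree`)
Let `L/F` be a finite Galois extension of number fields and `σ, τ ∈ Gal(L/F)` with `σ³ = 1`, `τ² = 1`,
`τσ = σ²τ`.  Then
  `ord₂ h(L) + 2·ord₂ h(L^{⟨σ,τ⟩}) = ord₂ h(L^{⟨σ⟩}) + 2·ord₂ h(L^{⟨τ⟩})`.
For `σ ≠ 1` this is the `2`-part of the Brauer–Kuroda relation `h(L) h(k)² ~ h(R) h(K)²` of the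
`S₃`-extension `L/k` (`k = L^{⟨σ,τ⟩}`, cubic-type subfield `K = L^τ`, quadratic resolvent `R = L^σ`), which
the analytic class number formula gives only up to a regulator quotient (trivial on `2`-parts:
[Bartel2012] Cor. 5.2) and which C. D. Walter / Caputo–Nuccio prove algebraically
([CaputoNuccio2020] Prop. 3.12, via the module identity Lemma 2.6 and a cohomological comparison Lemma 2.9).
att-p3 g33 landed the module identity in counting form with a SANDWICH for the ambiguous term
(`KurodaRelationSymmetricThree(Ambiguous).lean`); this file makes it exact.

## Proof (elementary; no Tate cohomology of `S₃`, no idèles, no `L`-functions)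
With `q = 2^m ≫ 0`, `a = #{c ∈ Cl(L)[q] : τc = c}`, `ρ = #{c ∈ Cl(L)[q] : σc = τc = c}`:
1. `#Cl(L)[q]·ρ² = #Cl(R)[q]·a²` (tree, `card_torsion_classGroup_symmetricThree`).
2. Chevalley's count for the two QUADRATIC steps (tree, recombined in `SymmetricThreeFixedClassesDescent`):
   `#Cl(L)^τ · #H¹(τ,E_L) = h_K · ∏e(L/K) · [E_K ∩ N : N E_L]` and
   `#Cl(R)^δ · #H¹(δ,E_R) = h_k · ∏e(R/k) · [E_k ∩ N : N E_R]` (`δ = τ|_R`).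
3. The three factors agree: `#H¹` and the unit index by `DihedralUnitCohomologyComparison.lean`
   (`E_K = E_k·N E_L`, `N₃`-descent of cocycles), `∏e` by `DihedralRamifiedPrimesComparison.lean`
   (one `τ`-inertial prime of `L` above each).  Hence `#Cl(L)^τ · h_k = #Cl(R)^δ · h_K`.
4. `2`-parts: `a = 2^{v₂ #Cl(L)^τ}`, `ρ = 2^{v₂ #Cl(R)^δ}` (coprime descent `Cl(R)[2^∞] ≅ Cl(L)[2^∞]^σ`
   intertwining `δ` and `τ`), so `e(L) + 2e(k) = e(R) + 2e(K)`.
The fields are handled as fixed fields over `k = L^{⟨σ,τ⟩}` and transported back (same carriers).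

Consequences (sequel `IwasawaTheory/SymmetricThreeTowerExact.lean`): along any `ℤ₂`-tower,
`e_n(L) + 2e_n(k) = e_n(R) + 2e_n(K)`, so `μ, λ, ν` of an `S₃`-sextic over `ℚ_n` are the resolvent's plus
twice the cubic's, with no `μ = 0` hypothesis (REF2 v63 §2 / v65 §1 of cell `bsd-f1-sign2`).

References: [CaputoNuccio2020] L. Caputo, F. A. E. Nuccio Mortarino Majno di Capriglio, *Class number formula for
dihedral extensions*, Glasgow Math. J. 62 (2020), Lemma 2.6, Lemma 2.9, Prop. 3.12, Rem. 3.13;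
[Walter1979Brauer] C. D. Walter, Acta Arith. 35 (1979); [Bartel2012] A. Bartel, J. reine angew. Math. 668 (2012)
Thm. 5.1, Cor. 5.2; [Lang1990] Ch. 13 §4 Lemma 4.1; [NeukirchANT1999] Ch. III §1 (1.6), Ch. I §9;
[Lemmermeyer1994] §1 (Kuroda's formula).
-/

noncomputable section

open scoped NumberField Classical

namespace Literature.NumberTheory.NumberFields.KurodaSymmetricThree

open NumberField IsDedekindDomain Literature.NumberTheory.NumberFields
  Literature.NumberTheory.NumberFields.AmbiguousClass Literature.NumberTheory.GaloisRepresentations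
  Literature.NumberTheory.GaloisRepresentations.Herbrand Literature.NumberTheory.GaloisRepresentations.MinkowskiUnit
  Literature.NumberTheory.GaloisRepresentations.CyclicNormIndex
  Literature.NumberTheory.NumberFields.DihedralUnits Literature.NumberTheory.NumberFields.DihedralPrimes

variable (F L : Type) [Field F] [NumberField F] [Field L] [NumberField L] [Algebra F L] [IsGalois F L]

/-! ### §1 The `2`-part of the class number as a torsion count; arithmetic -/

omit [NumberField F] [IsGalois F L] in
/-- `#Cl(M)[2^m] = 2^{ord₂ h(M)}` for `m ≥ ord₂ h(M)`. [cite: Washington1997, §10.1 (the `p`-part of the class group)] -/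
theorem natCard_torsion_eq_two_pow_padicValNat_classNumber {M : Type} [Field M] [NumberField M] {m : ℕ}
    (hm : padicValNat 2 (NumberField.classNumber M) ≤ m) :
    Nat.card {c : ClassGroup (𝓞 M) // c ^ 2 ^ m = 1} = 2 ^ padicValNat 2 (NumberField.classNumber M) := by
  haveI : Fact (Nat.Prime 2) := ⟨Nat.prime_two⟩
  have h : NumberField.classNumber M = Nat.card (ClassGroup (𝓞 M)) := by
    unfold NumberField.classNumber; rw [Nat.card_eq_fintype_card]
  rw [h] at hm ⊢
  exact natCard_torsion_pow_eq_pow_padicValNat hm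

omit [NumberField F] [NumberField L] [IsGalois F L] in
/-- `2`-adic valuations of a product identity. [cite: Washington1997, §10.1] -/
theorem padicValNat_add_eq_of_mul_eq {a b c d : ℕ} (h : a * b = c * d) (ha : a ≠ 0) (hb : b ≠ 0) (hc : c ≠ 0)
    (hd : d ≠ 0) : padicValNat 2 a + padicValNat 2 b = padicValNat 2 c + padicValNat 2 d := by
  haveI : Fact (Nat.Prime 2) := ⟨Nat.prime_two⟩
  rw [← padicValNat.mul ha hb, ← padicValNat.mul hc hd, h]

omit [NumberField F] [NumberField L] [IsGalois F L] in
/-- Exponent bookkeeping for `N_L ρ² = N_R a²` with all four terms powers of `2`. [cite: CaputoNuccio2020, Prop. 3.12] -/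
theorem add_two_mul_eq_of_pow_eq {NL ρ NR a eL eR vk vK : ℕ} (h : NL * ρ ^ 2 = NR * a ^ 2) (h1 : NL = 2 ^ eL)
    (h2 : NR = 2 ^ eR) (h3 : a = 2 ^ vK) (h4 : ρ = 2 ^ vk) : eL + 2 * vk = eR + 2 * vK := by
  subst h1 h2 h3 h4
  apply Nat.pow_right_injective (le_refl 2)
  calc 2 ^ (eL + 2 * vk) = 2 ^ eL * (2 ^ vk) ^ 2 := by ring
    _ = 2 ^ eR * (2 ^ vK) ^ 2 := h
    _ = 2 ^ (eR + 2 * vK) := by ring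

omit [NumberField F] [NumberField L] [IsGalois F L] in
/-- Final exponent bookkeeping. [cite: CaputoNuccio2020, Prop. 3.12] -/
theorem add_two_mul_eq_of_eqs {eL ek eR eK eK' vK vk : ℕ} (v1 : vK + ek = vk + eK') (v2 : eL + 2 * vk = eR + 2 * vK)
    (h : eK' = eK) : eL + 2 * ek = eR + 2 * eK := by
  omega

/-! ### §2b The two quadratic steps have proportional ambiguous class numbers -/

/-- **`#Cl(L)^τ · h(k) = #Cl(R)^δ · h(K)`** for an `S₃`-extension presented as an abstract tower (`K = L^τ`,
`R = L^σ`, `k = L^{σ,τ}`, `δ = τ|_R`): Chevalley's counts `#C^G · #H¹(E) = h · ∏e · [E ∩ N : N E]` for the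
quadratic steps `L/K` and `R/k` have the same three factors (`DihedralUnitCohomologyComparison.lean`,
`DihedralRamifiedPrimesComparison.lean`). [cite: CaputoNuccio2020, Prop. 3.12 (eq. (3.13) for `Σ` and `D`)] -/
theorem card_fixed_mul_classNumber_eq {k R L' K : Type} [Field k] [NumberField k] [Field R] [NumberField R]
    [Field L'] [NumberField L'] [Algebra k R] [Algebra k L'] [Algebra R L'] [IsScalarTower k R L'] [IsGalois k L']
    [IsGalois k R] [Field K] [NumberField K] [Algebra K L'] [IsGalois K L']
    {σ τ : L' ≃ₐ[k] L'} {τK : L' ≃ₐ[K] L'} {δ : R ≃ₐ[k] R} (hσ : σ ^ 3 = 1) (hτ : τ ^ 2 = 1)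
    (hτσ : τ * σ = σ ^ 2 * τ) (hτ1 : τ ≠ 1) (hgen : ∀ g : L' ≃ₐ[k] L', ∃ i j : ℕ, j < 2 ∧ g = σ ^ i * τ ^ j)
    (hτK : ∀ x : L', τK x = τ x) (hgenK : ∀ g : L' ≃ₐ[K] L', g ∈ Subgroup.zpowers τK)
    (hR : ∀ x : L', σ x = x ↔ x ∈ Set.range (algebraMap R L'))
    (hδ : ∀ y : R, algebraMap R L' (δ y) = τ (algebraMap R L' y))
    (hgenk : ∀ g : R ≃ₐ[k] R, g ∈ Subgroup.zpowers δ) (hδ1 : δ ≠ 1) :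
    Nat.card {c : ClassGroup (𝓞 L') // ∀ g : L' ≃ₐ[K] L', ClassGroup.mulEquiv (intAut g) c = c} *
        NumberField.classNumber k =
      Nat.card {d : ClassGroup (𝓞 R) // ∀ g : R ≃ₐ[k] R, ClassGroup.mulEquiv (intAut g) d = d} *
        NumberField.classNumber K := by
  have hB := card_fixed_mul_h1_unitsE_eq (K := K) (L := L') hgenK
  have hC := card_fixed_mul_h1_unitsE_eq (K := k) (L := R) hgenk
  have hHne := h1_unitsE_ne_zero (K := K) (L := L') hgenK
  have hH := h1_unitsE_eq hσ hτ hτσ hτ1 hτK hgenK hR hδ hgenk hδ1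
  have hI := relIndex_norm_unitsE_eq hσ hτ hτσ hτ1 hτK hgenK hR hδ hgenk hδ1
  have hP := finprod_ramificationIdxIn_quadratic_step_eq hσ hτ hτσ hτ1 hgen hτK hgenK hR hδ hgenk hδ1
  rw [hH, hI, hP] at hB
  rw [hH] at hHne
  apply Nat.eq_of_mul_eq_mul_right (Nat.pos_of_ne_zero hHne)
  calc Nat.card {c : ClassGroup (𝓞 L') // ∀ g : L' ≃ₐ[K] L', ClassGroup.mulEquiv (intAut g) c = c} *
        NumberField.classNumber k * h1 δ (unitsE R) ⊥
      = (Nat.card {c : ClassGroup (𝓞 L') // ∀ g : L' ≃ₐ[K] L', ClassGroup.mulEquiv (intAut g) c = c} *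
          h1 δ (unitsE R) ⊥) * NumberField.classNumber k := by ring
    _ = (Nat.card {d : ClassGroup (𝓞 R) // ∀ g : R ≃ₐ[k] R, ClassGroup.mulEquiv (intAut g) d = d} *
          h1 δ (unitsE R) ⊥) * NumberField.classNumber K := by rw [hB, hC]; ring
    _ = Nat.card {d : ClassGroup (𝓞 R) // ∀ g : R ≃ₐ[k] R, ClassGroup.mulEquiv (intAut g) d = d} *
          NumberField.classNumber K * h1 δ (unitsE R) ⊥ := by ring

/-! ### §2c The torsion counts: `e(L) + 2·v₂#Cl(R)^δ = e(L^σ) + 2·v₂#Cl(L)^τ` -/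

/-- **`ord₂ h(L) + 2·ord₂ #Cl(R)^δ = ord₂ h(L^σ) + 2·ord₂ #Cl(L)^{τK}`** — att-p3's count
`#Cl(L)[2^m]·ρ² = #Cl(L^σ)[2^m]·a²` with `a = 2^{ord₂ #Cl(L)^{τK}}`, `ρ = 2^{ord₂ #Cl(R)^δ}` (`R = L^{σ₁}` over `k`,
`σ₁, τ₁` acting as `σ, τ`). [cite: CaputoNuccio2020, Lemma 2.6, Prop. 3.12] -/
theorem padicValNat_torsion_counts {k : Type} [Field k] [NumberField k] [Algebra k L] [IsGalois k L]
    {σ τ : L ≃ₐ[F] L} {σ₁ τ₁ : L ≃ₐ[k] L}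
    {τK : L ≃ₐ[↥(IntermediateField.fixedField (Subgroup.zpowers τ₁))] L}
    {δ : ↥(IntermediateField.fixedField (Subgroup.zpowers σ₁)) ≃ₐ[k] ↥(IntermediateField.fixedField (Subgroup.zpowers σ₁))}
    (hσ : σ ^ 3 = 1) (hτ : τ ^ 2 = 1) (hτσ : τ * σ = σ ^ 2 * τ) (eσ : ∀ x, σ₁ x = σ x) (eτ : ∀ x, τ₁ x = τ x)
    (hodd : ¬ 2 ∣ Module.finrank ↥(IntermediateField.fixedField (Subgroup.zpowers σ₁)) L)
    (hτK : ∀ x : L, τK x = τ₁ x)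
    (hgenK : ∀ g : L ≃ₐ[↥(IntermediateField.fixedField (Subgroup.zpowers τ₁))] L, g ∈ Subgroup.zpowers τK)
    (hδ : ∀ y, algebraMap _ L (δ y) = τ₁ (algebraMap _ L y))
    (hgenk : ∀ g : ↥(IntermediateField.fixedField (Subgroup.zpowers σ₁)) ≃ₐ[k]
      ↥(IntermediateField.fixedField (Subgroup.zpowers σ₁)), g ∈ Subgroup.zpowers δ) :
    padicValNat 2 (NumberField.classNumber L) + 2 * padicValNat 2 (Nat.card
        {d : ClassGroup (𝓞 ↥(IntermediateField.fixedField (Subgroup.zpowers σ₁))) //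
          ∀ g : ↥(IntermediateField.fixedField (Subgroup.zpowers σ₁)) ≃ₐ[k]
            ↥(IntermediateField.fixedField (Subgroup.zpowers σ₁)), ClassGroup.mulEquiv (intAut g) d = d}) =
      padicValNat 2 (NumberField.classNumber ↥(IntermediateField.fixedField (Subgroup.zpowers σ))) +
        2 * padicValNat 2 (Nat.card {c : ClassGroup (𝓞 L) //
          ∀ g : L ≃ₐ[↥(IntermediateField.fixedField (Subgroup.zpowers τ₁))] L, ClassGroup.mulEquiv (intAut g) c = c}) := by
  classical
  haveI : Fact (Nat.Prime 2) := ⟨Nat.prime_two⟩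
  -- a uniform torsion exponent
  obtain ⟨m, hm⟩ : ∃ m : ℕ, m = padicValNat 2 (NumberField.classNumber L) +
      padicValNat 2 (NumberField.classNumber ↥(IntermediateField.fixedField (Subgroup.zpowers σ))) +
      padicValNat 2 (Nat.card {c : ClassGroup (𝓞 L) //
        ∀ g : L ≃ₐ[↥(IntermediateField.fixedField (Subgroup.zpowers τ₁))] L, ClassGroup.mulEquiv (intAut g) c = c}) +
      padicValNat 2 (Nat.card {d : ClassGroup (𝓞 ↥(IntermediateField.fixedField (Subgroup.zpowers σ₁))) //
        ∀ g : ↥(IntermediateField.fixedField (Subgroup.zpowers σ₁)) ≃ₐ[k]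
          ↥(IntermediateField.fixedField (Subgroup.zpowers σ₁)), ClassGroup.mulEquiv (intAut g) d = d}) := ⟨_, rfl⟩
  have hmA : padicValNat 2 (NumberField.classNumber L) ≤ m := by
    rw [hm]; exact le_trans (le_trans (Nat.le_add_right _ _) (Nat.le_add_right _ _)) (Nat.le_add_right _ _)
  have hmB : padicValNat 2 (NumberField.classNumber ↥(IntermediateField.fixedField (Subgroup.zpowers σ))) ≤ m := by
    rw [hm]; exact le_trans (le_trans (Nat.le_add_left _ _) (Nat.le_add_right _ _)) (Nat.le_add_right _ _)
  have hmC : padicValNat 2 (Nat.card {c : ClassGroup (𝓞 L) //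
      ∀ g : L ≃ₐ[↥(IntermediateField.fixedField (Subgroup.zpowers τ₁))] L, ClassGroup.mulEquiv (intAut g) c = c}) ≤ m := by
    rw [hm]; exact le_trans (Nat.le_add_left _ _) (Nat.le_add_right _ _)
  have hmD : padicValNat 2 (Nat.card {d : ClassGroup (𝓞 ↥(IntermediateField.fixedField (Subgroup.zpowers σ₁))) //
      ∀ g : ↥(IntermediateField.fixedField (Subgroup.zpowers σ₁)) ≃ₐ[k]
        ↥(IntermediateField.fixedField (Subgroup.zpowers σ₁)), ClassGroup.mulEquiv (intAut g) d = d}) ≤ m := by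
    rw [hm]; exact Nat.le_add_left _ _
  -- the `S₃` count at level `F`
  have hq : Nat.Coprime 3 (2 ^ m) := Nat.Coprime.pow_right m (by norm_num)
  have hA := card_torsion_classGroup_symmetricThree F L σ τ hσ hτ hτσ hq
  -- `intAut` of the lifts
  have hiτK : intAut τK = intAut τ :=
    RingEquiv.ext fun x => NumberField.RingOfIntegers.ext ((hτK x).trans (eτ x))
  have hiσ : intAut σ₁ = intAut σ := RingEquiv.ext fun x => NumberField.RingOfIntegers.ext (eσ x)
  have hiτ : intAut τ₁ = intAut τ := RingEquiv.ext fun x => NumberField.RingOfIntegers.ext (eτ x)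
  -- the four powers of `2`
  have ha' := natCard_torsion_fixed_eq_two_pow (K := ↥(IntermediateField.fixedField (Subgroup.zpowers τ₁))) (L := L)
    (σ := τK) hgenK (m := m) hmC
  have ha : Nat.card {c : ClassGroup (𝓞 L) // c ^ 2 ^ m = 1 ∧ ClassGroup.mulEquiv (intAut τ) c = c} =
      2 ^ padicValNat 2 (Nat.card {c : ClassGroup (𝓞 L) //
        ∀ g : L ≃ₐ[↥(IntermediateField.fixedField (Subgroup.zpowers τ₁))] L, ClassGroup.mulEquiv (intAut g) c = c}) :=
    (Nat.card_congr (Equiv.subtypeEquivRight fun c => by rw [hiτK])).trans ha'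
  have hρ₁ := natCard_torsion_fixed_fixed_eq k L σ₁ τ₁ hodd δ hδ m
  have hρ₂ := natCard_torsion_fixed_eq_two_pow (K := k) (L := ↥(IntermediateField.fixedField (Subgroup.zpowers σ₁)))
    (σ := δ) hgenk (m := m) hmD
  have hρ : Nat.card {c : ClassGroup (𝓞 L) // c ^ 2 ^ m = 1 ∧ ClassGroup.mulEquiv (intAut σ) c = c ∧
      ClassGroup.mulEquiv (intAut τ) c = c} = 2 ^ padicValNat 2 (Nat.card
        {d : ClassGroup (𝓞 ↥(IntermediateField.fixedField (Subgroup.zpowers σ₁))) //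
          ∀ g : ↥(IntermediateField.fixedField (Subgroup.zpowers σ₁)) ≃ₐ[k]
            ↥(IntermediateField.fixedField (Subgroup.zpowers σ₁)), ClassGroup.mulEquiv (intAut g) d = d}) :=
    ((Nat.card_congr (Equiv.subtypeEquivRight fun c => by rw [hiσ, hiτ])).trans hρ₁).trans hρ₂
  have hNL := natCard_torsion_eq_two_pow_padicValNat_classNumber (M := L) (m := m) hmA
  have hNR := natCard_torsion_eq_two_pow_padicValNat_classNumber
    (M := ↥(IntermediateField.fixedField (Subgroup.zpowers σ))) (m := m) hmB
  exact add_two_mul_eq_of_pow_eq hA hNL hNR ha hρ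

/-! ### §3 The degenerate case `σ = 1` -/

omit [IsGalois F L] in
/-- For `σ = 1` the relation is `e(L) + 2e(L^τ) = e(L) + 2e(L^τ)`. [cite: CaputoNuccio2020, Prop. 3.12] -/
theorem padicValNat_two_classNumber_of_sigma_eq_one (τ : L ≃ₐ[F] L) :
    padicValNat 2 (NumberField.classNumber L) +
        2 * padicValNat 2 (NumberField.classNumber ↥(IntermediateField.fixedField (Subgroup.closure ({1, τ} : Set (L ≃ₐ[F] L))))) =
      padicValNat 2 (NumberField.classNumber ↥(IntermediateField.fixedField (Subgroup.zpowers (1 : L ≃ₐ[F] L)))) +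
        2 * padicValNat 2 (NumberField.classNumber ↥(IntermediateField.fixedField (Subgroup.zpowers τ))) := by
  have h1 : Subgroup.closure ({1, τ} : Set (L ≃ₐ[F] L)) = Subgroup.zpowers τ := by
    refine le_antisymm ((Subgroup.closure_le _).mpr ?_) ?_
    · rintro g (rfl | rfl)
      · exact Subgroup.one_mem _
      · exact Subgroup.mem_zpowers g
    · exact (Subgroup.zpowers_le (G := L ≃ₐ[F] L)).mpr (Subgroup.subset_closure (by simp))
  have h2 : ∀ x : L, x ∈ IntermediateField.fixedField (Subgroup.zpowers (1 : L ≃ₐ[F] L)) ↔ x ∈ (⊤ : IntermediateField F L) := by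
    intro x
    simp only [IntermediateField.mem_top, iff_true, IntermediateField.mem_fixedField_iff]
    intro f hf
    rw [Subgroup.zpowers_one_eq_bot, Subgroup.mem_bot] at hf
    rw [hf, AlgEquiv.one_apply]
  obtain ⟨eK⟩ := nonempty_ringEquiv_of_forall_mem_iff F L (IntermediateField.fixedField (Subgroup.closure ({1, τ} : Set (L ≃ₐ[F] L))))
    (IntermediateField.fixedField (Subgroup.zpowers τ)) (fun x => by rw [h1])
  obtain ⟨eT⟩ := nonempty_ringEquiv_of_forall_mem_iff F L (IntermediateField.fixedField (Subgroup.zpowers (1 : L ≃ₐ[F] L)))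
    (⊤ : IntermediateField F L) h2
  rw [classNumber_eq_of_ringEquiv_aux eK, classNumber_eq_of_ringEquiv_aux eT,
    classNumber_eq_of_ringEquiv_aux (IntermediateField.topEquiv (F := F) (E := L)).toRingEquiv]

/-! ### §4 The main theorem -/

set_option maxHeartbeats 400000 in
/-- **THE EXACT `2`-PART OF THE `S₃` CLASS NUMBER RELATION (Walter; Caputo–Nuccio Prop. 3.12; Bartel Cor. 5.2).**
For a finite Galois extension `L/F` of number fields and `σ, τ ∈ Gal(L/F)` with `σ³ = 1`, `τ² = 1`, `τσ = σ²τ`: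

  `ord₂ h(L) + 2·ord₂ h(L^{⟨σ,τ⟩}) = ord₂ h(L^{⟨σ⟩}) + 2·ord₂ h(L^{⟨τ⟩})`,

i.e. `h₂(L)·h₂(k)² = h₂(R)·h₂(K)²` for the `S₃`-extension `L/k` (`k = L^{⟨σ,τ⟩}`) with cubic-type subfield
`K = L^τ` and quadratic resolvent `R = L^σ` — no `μ = 0`, `2`-freeness or odd-class-number hypotheses.
Walter's hypotheses, verbatim: ANY base number field `k` and ANY Galois extension `L/k` with group `S₃ = D₃` (here: any Galois `L/F`
and any such pair `σ, τ`, the base being `k = L^{⟨σ,τ⟩} ⊇ F`, so every `S₃`-extension of number fields is covered; `σ = 1` is the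
degenerate quadratic case), no class-number proviso.
Proof: §-header of this file. [cite: CaputoNuccio2020, Prop. 3.12, Rem. 3.13] [cite: Bartel2012, Cor. 5.2]
[cite: Walter1979Brauer, Thm.] -/
theorem padicValNat_two_classNumber_symmetricThree (σ τ : L ≃ₐ[F] L) (hσ : σ ^ 3 = 1) (hτ : τ ^ 2 = 1)
    (hτσ : τ * σ = σ ^ 2 * τ) :
    padicValNat 2 (NumberField.classNumber L) +
        2 * padicValNat 2 (NumberField.classNumber ↥(IntermediateField.fixedField (Subgroup.closure ({σ, τ} : Set (L ≃ₐ[F] L))))) =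
      padicValNat 2 (NumberField.classNumber ↥(IntermediateField.fixedField (Subgroup.zpowers σ))) +
        2 * padicValNat 2 (NumberField.classNumber ↥(IntermediateField.fixedField (Subgroup.zpowers τ))) := by
  classical
  by_cases hσ1 : σ = 1
  · subst hσ1; exact padicValNat_two_classNumber_of_sigma_eq_one F L τ
  haveI : FiniteDimensional F L := Module.Finite.of_restrictScalars_finite ℚ F L
  haveI : Fact (Nat.Prime 2) := ⟨Nat.prime_two⟩
  have hτ1 : τ ≠ 1 := tau_ne_one hσ hτσ hσ1
  -- the group `D = ⟨σ,τ⟩` and the base `k = L^D`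
  have hσD : σ ∈ (Subgroup.closure ({σ, τ} : Set (L ≃ₐ[F] L))) := Subgroup.subset_closure (by simp)
  have hτD : τ ∈ (Subgroup.closure ({σ, τ} : Set (L ≃ₐ[F] L))) := Subgroup.subset_closure (by simp)
  have hcardD : Nat.card (Subgroup.closure ({σ, τ} : Set (L ≃ₐ[F] L))) = 6 := card_closure_eq_six hσ hτ hτσ hσ1
  have hmemk : ∀ {g : L ≃ₐ[F] L}, g ∈ (Subgroup.closure ({σ, τ} : Set (L ≃ₐ[F] L))) → ∀ x : ↥(IntermediateField.fixedField (Subgroup.closure ({σ, τ} : Set (L ≃ₐ[F] L)))), g (x : L) = x := fun {g} hg x =>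
    (IntermediateField.mem_fixedField_iff (Subgroup.closure ({σ, τ} : Set (L ≃ₐ[F] L))) (x : L)).mp x.2 g hg
  let σ₁ : L ≃ₐ[↥(IntermediateField.fixedField (Subgroup.closure ({σ, τ} : Set (L ≃ₐ[F] L))))] L := { σ with commutes' := fun x => hmemk hσD x }
  let τ₁ : L ≃ₐ[↥(IntermediateField.fixedField (Subgroup.closure ({σ, τ} : Set (L ≃ₐ[F] L))))] L := { τ with commutes' := fun x => hmemk hτD x }
  have eσ : ∀ x, σ₁ x = σ x := fun _ => rfl
  have eτ : ∀ x, τ₁ x = τ x := fun _ => rfl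
  have hσ₁ : σ₁ ^ 3 = 1 := AlgEquiv.ext fun x => by
    rw [pow_apply_eq_pow_apply F L eσ, hσ, AlgEquiv.one_apply, AlgEquiv.one_apply]
  have hτ₁ : τ₁ ^ 2 = 1 := AlgEquiv.ext fun x => by
    rw [pow_apply_eq_pow_apply F L eτ, hτ, AlgEquiv.one_apply, AlgEquiv.one_apply]
  have hτσ₁ : τ₁ * σ₁ = σ₁ ^ 2 * τ₁ := AlgEquiv.ext fun x => by
    rw [AlgEquiv.mul_apply, AlgEquiv.mul_apply, pow_apply_eq_pow_apply F L eσ, eσ, eτ, eτ,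
      ← AlgEquiv.mul_apply, hτσ, AlgEquiv.mul_apply]
  have hσ₁1 : σ₁ ≠ 1 := fun h => hσ1 (AlgEquiv.ext fun x => by
    rw [← eσ, h, AlgEquiv.one_apply, AlgEquiv.one_apply])
  have hτ₁1 : τ₁ ≠ 1 := tau_ne_one hσ₁ hτσ₁ hσ₁1
  -- `Gal(L/k) = {σ₁ⁱ τ₁ʲ}`, of order `6`
  have hres : ∀ g : L ≃ₐ[↥(IntermediateField.fixedField (Subgroup.closure ({σ, τ} : Set (L ≃ₐ[F] L))))] L, g.restrictScalars F ∈ (Subgroup.closure ({σ, τ} : Set (L ≃ₐ[F] L))) := fun g => by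
    have h : g.restrictScalars F ∈ IntermediateField.fixingSubgroup (IntermediateField.fixedField (Subgroup.closure ({σ, τ} : Set (L ≃ₐ[F] L)))) :=
      fun x => g.commutes x
    rwa [IntermediateField.fixingSubgroup_fixedField] at h
  have hgen₁ : ∀ g : L ≃ₐ[↥(IntermediateField.fixedField (Subgroup.closure ({σ, τ} : Set (L ≃ₐ[F] L))))] L, ∃ i j : ℕ, j < 2 ∧ g = σ₁ ^ i * τ₁ ^ j := by
    intro g
    obtain ⟨i, j, -, hj, h⟩ := exists_pow_mul_pow_of_mem_closure hσ hτ hτσ (hres g)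
    refine ⟨i, j, hj, AlgEquiv.ext fun x => ?_⟩
    rw [AlgEquiv.mul_apply, pow_apply_eq_pow_apply F L eτ, pow_apply_eq_pow_apply F L eσ, ← AlgEquiv.mul_apply,
      ← h]
    rfl
  have hmem₁ : ∀ g : L ≃ₐ[↥(IntermediateField.fixedField (Subgroup.closure ({σ, τ} : Set (L ≃ₐ[F] L))))] L, g ∈ Subgroup.closure ({σ₁, τ₁} : Set (L ≃ₐ[↥(IntermediateField.fixedField (Subgroup.closure ({σ, τ} : Set (L ≃ₐ[F] L))))] L)) := by
    intro g
    obtain ⟨i, j, -, rfl⟩ := hgen₁ g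
    exact Subgroup.mul_mem _ (Subgroup.pow_mem _ (Subgroup.subset_closure (by simp)) _)
      (Subgroup.pow_mem _ (Subgroup.subset_closure (by simp)) _)
  have hcardk : Nat.card (L ≃ₐ[↥(IntermediateField.fixedField (Subgroup.closure ({σ, τ} : Set (L ≃ₐ[F] L))))] L) = 6 := by
    rw [IsGalois.card_aut_eq_finrank, IntermediateField.finrank_fixedField_eq_card, hcardD]
  -- the field `K = L^τ` over `k`, its Galois group `⟨τK⟩`
  have hmemK : ∀ x : ↥(IntermediateField.fixedField (Subgroup.zpowers τ₁)), τ (x : L) = x := fun x =>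
    (IntermediateField.mem_fixedField_iff (Subgroup.zpowers τ₁) (x : L)).mp x.2 τ₁ (Subgroup.mem_zpowers τ₁)
  let τK : L ≃ₐ[↥(IntermediateField.fixedField (Subgroup.zpowers τ₁))] L := { τ with commutes' := fun x => hmemK x }
  have hτK : ∀ x, τK x = τ₁ x := fun _ => rfl
  have hgenK : ∀ g : L ≃ₐ[↥(IntermediateField.fixedField (Subgroup.zpowers τ₁))] L, g ∈ Subgroup.zpowers τK := by
    intro g
    have hg : g.restrictScalars ↥(IntermediateField.fixedField (Subgroup.closure ({σ, τ} : Set (L ≃ₐ[F] L)))) ∈ Subgroup.zpowers τ₁ := by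
      have h : g.restrictScalars ↥(IntermediateField.fixedField (Subgroup.closure ({σ, τ} : Set (L ≃ₐ[F] L)))) ∈
          IntermediateField.fixingSubgroup (IntermediateField.fixedField (Subgroup.zpowers τ₁)) :=
        fun x => g.commutes x
      rwa [IntermediateField.fixingSubgroup_fixedField] at h
    rcases eq_one_or_eq_of_mem_zpowers hτ₁ hg with h | h
    · have hg1 : g = 1 := AlgEquiv.ext fun x => by
        have := AlgEquiv.congr_fun h x
        simpa using this
      rw [hg1]; exact Subgroup.one_mem _
    · have hg1 : g = τK := AlgEquiv.ext fun x => by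
        have := AlgEquiv.congr_fun h x
        rw [hτK]
        simpa using this
      rw [hg1]; exact Subgroup.mem_zpowers τK
  -- the resolvent `R = L^σ` over `k`, its Galois group `⟨δ⟩`
  haveI hN : (Subgroup.zpowers σ₁).Normal :=
    ⟨fun n hn g => conj_mem_zpowers_of_mem_closure hσ₁ hτ₁ hτσ₁ (hmem₁ g) hn⟩
  haveI : IsGalois ↥(IntermediateField.fixedField (Subgroup.closure ({σ, τ} : Set (L ≃ₐ[F] L)))) ↥(IntermediateField.fixedField (Subgroup.zpowers σ₁)) :=
    IsGalois.of_fixedField_normal_subgroup (Subgroup.zpowers σ₁)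
  let δ : ↥(IntermediateField.fixedField (Subgroup.zpowers σ₁)) ≃ₐ[↥(IntermediateField.fixedField (Subgroup.closure ({σ, τ} : Set (L ≃ₐ[F] L))))]
      ↥(IntermediateField.fixedField (Subgroup.zpowers σ₁)) :=
    τ₁.restrictNormal ↥(IntermediateField.fixedField (Subgroup.zpowers σ₁))
  have hδ : ∀ y, algebraMap _ L (δ y) = τ₁ (algebraMap _ L y) :=
    fun y => AlgEquiv.restrictNormal_commutes τ₁ ↥(IntermediateField.fixedField (Subgroup.zpowers σ₁)) y
  have hR : ∀ x : L, σ₁ x = x ↔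
      x ∈ Set.range (algebraMap ↥(IntermediateField.fixedField (Subgroup.zpowers σ₁)) L) := by
    intro x
    constructor
    · intro hx
      refine ⟨⟨x, (IntermediateField.mem_fixedField_iff (Subgroup.zpowers σ₁) x).mpr fun f hf => ?_⟩, rfl⟩
      have hle : Subgroup.zpowers σ₁ ≤ MulAction.stabilizer (L ≃ₐ[↥(IntermediateField.fixedField (Subgroup.closure ({σ, τ} : Set (L ≃ₐ[F] L))))] L) x :=
        (Subgroup.zpowers_le (G := L ≃ₐ[↥(IntermediateField.fixedField (Subgroup.closure ({σ, τ} : Set (L ≃ₐ[F] L))))] L)).mpr hx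
      exact hle hf
    · rintro ⟨y, rfl⟩
      exact (IntermediateField.mem_fixedField_iff (Subgroup.zpowers σ₁) (y : L)).mp y.2 σ₁
        (Subgroup.mem_zpowers σ₁)
  have hδ1 : δ ≠ 1 := by
    intro h
    apply not_mem_zpowers_of_orders hσ₁ hτ₁ hτ₁1
    rw [← IntermediateField.fixingSubgroup_fixedField (Subgroup.zpowers σ₁),
      IntermediateField.mem_fixingSubgroup_iff]
    intro x hx
    have := hδ ⟨x, hx⟩
    rw [h, AlgEquiv.one_apply] at this
    exact this.symm
  have hδ2 : δ ^ 2 = 1 := delta_sq hτ₁ hδ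
  have hRL : Module.finrank ↥(IntermediateField.fixedField (Subgroup.zpowers σ₁)) L = 3 := by
    rw [IntermediateField.finrank_fixedField_eq_card, Nat.card_zpowers, orderOf_eq_prime hσ₁ hσ₁1]
  have hodd : ¬ 2 ∣ Module.finrank ↥(IntermediateField.fixedField (Subgroup.zpowers σ₁)) L := by
    rw [hRL]; decide
  have hgenk : ∀ g : ↥(IntermediateField.fixedField (Subgroup.zpowers σ₁)) ≃ₐ[↥(IntermediateField.fixedField (Subgroup.closure ({σ, τ} : Set (L ≃ₐ[F] L))))]
      ↥(IntermediateField.fixedField (Subgroup.zpowers σ₁)), g ∈ Subgroup.zpowers δ := by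
    have hkR : Module.finrank ↥(IntermediateField.fixedField (Subgroup.closure ({σ, τ} : Set (L ≃ₐ[F] L)))) ↥(IntermediateField.fixedField (Subgroup.zpowers σ₁)) = 2 := by
      have h := Module.finrank_mul_finrank ↥(IntermediateField.fixedField (Subgroup.closure ({σ, τ} : Set (L ≃ₐ[F] L)))) ↥(IntermediateField.fixedField (Subgroup.zpowers σ₁)) L
      rw [hRL, ← IsGalois.card_aut_eq_finrank ↥(IntermediateField.fixedField (Subgroup.closure ({σ, τ} : Set (L ≃ₐ[F] L)))) L, hcardk] at h
      omega
    have htop : Subgroup.zpowers δ = ⊤ := by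
      apply Subgroup.eq_top_of_card_eq
      rw [Nat.card_zpowers, orderOf_eq_prime hδ2 hδ1, IsGalois.card_aut_eq_finrank, hkR]
    intro g
    rw [htop]; exact Subgroup.mem_top g
  -- STEP 1: `#Cl(L)^τ · h(k) = #Cl(R)^δ · h(K)` and its `2`-adic valuation
  haveI : Nonempty {c : ClassGroup (𝓞 L) // ∀ g : L ≃ₐ[↥(IntermediateField.fixedField (Subgroup.zpowers τ₁))] L, ClassGroup.mulEquiv (intAut g) c = c} := ⟨⟨1, fun g => map_one _⟩⟩
  haveI : Nonempty {d : ClassGroup (𝓞 ↥(IntermediateField.fixedField (Subgroup.zpowers σ₁))) // ∀ g : ↥(IntermediateField.fixedField (Subgroup.zpowers σ₁)) ≃ₐ[↥(IntermediateField.fixedField (Subgroup.closure ({σ, τ} : Set (L ≃ₐ[F] L))))] ↥(IntermediateField.fixedField (Subgroup.zpowers σ₁)), ClassGroup.mulEquiv (intAut g) d = d} := ⟨⟨1, fun g => map_one _⟩⟩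
  have hcl0 : ∀ (M : Type) [Field M] [NumberField M], NumberField.classNumber M ≠ 0 := fun M _ _ => by
    unfold NumberField.classNumber; exact Fintype.card_ne_zero
  have hCC := card_fixed_mul_classNumber_eq (k := ↥(IntermediateField.fixedField (Subgroup.closure ({σ, τ} : Set (L ≃ₐ[F] L))))) (R := ↥(IntermediateField.fixedField (Subgroup.zpowers σ₁))) (L' := L) (K := ↥(IntermediateField.fixedField (Subgroup.zpowers τ₁))) (σ := σ₁) (τ := τ₁)
    (τK := τK) (δ := δ) hσ₁ hτ₁ hτσ₁ hτ₁1 hgen₁ hτK hgenK hR hδ hgenk hδ1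
  have v1 := padicValNat_add_eq_of_mul_eq hCC Nat.card_pos.ne' (hcl0 ↥(IntermediateField.fixedField (Subgroup.closure ({σ, τ} : Set (L ≃ₐ[F] L))))) Nat.card_pos.ne' (hcl0 ↥(IntermediateField.fixedField (Subgroup.zpowers τ₁)))
  -- STEP 2: the torsion counts
  have v2 := padicValNat_torsion_counts F L (k := ↥(IntermediateField.fixedField (Subgroup.closure ({σ, τ} : Set (L ≃ₐ[F] L))))) hσ hτ hτσ eσ eτ hodd hτK hgenK hδ hgenk
  -- STEP 3: `K = L^τ` over `k` and over `F` have the same class number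
  obtain ⟨eK⟩ := nonempty_ringEquiv_of_forall_mem_iff F L (IntermediateField.fixedField (Subgroup.zpowers τ))
    (IntermediateField.fixedField (Subgroup.zpowers τ₁)) (fun x => by
      rw [IntermediateField.mem_fixedField_iff, IntermediateField.mem_fixedField_iff, forall_mem_zpowers_apply_eq_iff,
        forall_mem_zpowers_apply_eq_iff, eτ])
  exact add_two_mul_eq_of_eqs v1 v2 (congrArg (padicValNat 2) (classNumber_eq_of_ringEquiv_aux eK).symm)

end Literature.NumberTheory.NumberFields.KurodaSymmetricThree
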